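import Literature.AlgebraicGeometry.Frobenioids.QuasiTemperoidConnected
import Literature.AlgebraicGeometry.Frobenioids.BCatOrbits
import Mathlib.Topology.Algebra.OpenSubgroup
import Mathlib.CategoryTheory.EssentialImage
import HarnessLib

/-!
# Frobenioids II, Example 1.3 (i): `B^temp(Π)⁰ ≃ B(Π)⁰` for profinite `Π` (proof)

Mochizuki, *The geometry of Frobenioids II*, Kyushu J. Math. **62** (2008) 401–460, §1 Example 1.3
(i), author's text p. 11 [cite: MochizukiFrdII2008, Ex 1.3 (i) p.11]: "Thus, if `Π` is profinite, then
it is tempered, and there is a natural equivalence of categories `B^temp(Π)⁰ ⥲ B(Π)⁰`".  The statement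
file `Literature.AlgebraicGeometry.Frobenioids.QuasiTemperoid` records this sentence as the named fact
`QuasiTemperoid.ConnectedPartEquivOfProfinite`; this proof-only companion discharges it
(`connectedPartEquivOfProfinite_holds`).

Proof.  A finite set with continuous `Π`-action is a countable discrete `Π`-set with open stabilisers,
so there is a forgetful functor `B(Π) → B^temp(Π)`; connected objects on both sides are the single
orbits (`BCat.isConnectedObj_iff`, abc-iut-L1-d9; `QuasiTemperoid.BTempConnected.isConnectedObj_iff`,
abc-iut-L1-d5), so it restricts to `B(Π)⁰ → B^temp(Π)⁰`, where it is fully faithful (morphisms on both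
sides are the equivariant maps) and essentially surjective: a single orbit with open stabiliser `U` is
`Π/U`, which is FINITE because an open subgroup of a compact group has finite index.  (Only
compactness of `Π` is used.)  Proof-only: no definitions.
-/

open CategoryTheory Topology
open scoped FintypeCatDiscrete
open Literature.AnabelianGeometry.SemiGraphs

namespace Literature.AlgebraicGeometry.Frobenioids

namespace QuasiTemperoid

universe u

variable {G : Type u} [Group G] [TopologicalSpace G]

variable (G) in
/-- **Example 1.3 (i)** (FrdII p. 11), PROVED: "if `Π` is profinite, then … there is a natural equivalence
of categories `B^temp(Π)⁰ ⥲ B(Π)⁰`" — the forgetful functor `B(Π)⁰ → B^temp(Π)⁰` is fully faithful and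
essentially surjective (open subgroups of a compact group have finite index).
[cite: MochizukiFrdII2008, Ex 1.3 (i) p.11] -/
theorem connectedPartEquivOfProfinite_holds : ConnectedPartEquivOfProfinite G := by
  intro _ _ _
  classical
  -- a finite continuous `Π`-set is an object of `B^temp(Π)`
  have htemp : ∀ X : BCat G, temperedAction G (Action.ofMulAction G X.obj.V) := fun X => by
    refine ⟨?_, fun x => ?_⟩
    · change Countable X.obj.V
      infer_instance
    · exact BCat.isOpen_stabilizer X x
  let T : BCat G → BTemp G := fun X => ⟨Action.ofMulAction G X.obj.V, htemp X⟩
  have hconn : ∀ X : BCat G, IsConnectedObj X → IsConnectedObj (T X) := fun X hX => by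
    obtain ⟨x₀, htr⟩ := (BCat.isConnectedObj_iff X).mp hX
    exact BTempConnected.isConnectedObj_of_transitive (T X) x₀ fun x => htr x
  /- ## the forgetful functor on connected parts -/
  let Ψ : ConnectedPart (BCat G) ⥤ ConnectedPart (BTemp G) :=
    { obj := fun X => ⟨T X.obj, hconn X.obj X.property⟩
      map := fun {X Y} f => ObjectProperty.homMk (ObjectProperty.homMk
        { hom := TypeCat.ofHom fun x : X.obj.obj.V => (f.hom.hom.hom x : Y.obj.obj.V)
          comm := fun g => by
            apply ConcreteCategory.hom_ext
            intro x
            exact BCat.hom_smul f.hom g x })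
      map_id := fun X => by
        apply ObjectProperty.hom_ext
        apply BTempConnected.hom_ext_apply
        intro x
        rfl
      map_comp := fun f g => by
        apply ObjectProperty.hom_ext
        apply BTempConnected.hom_ext_apply
        intro x
        rfl }
  have hΨ : ∀ {X Y : ConnectedPart (BCat G)} (f : X ⟶ Y) (x : X.obj.obj.V),
      ((Ψ.map f).hom.hom.hom x : Y.obj.obj.V) = f.hom.hom.hom x := fun _ _ => rfl
  /- ## faithful -/
  haveI : Ψ.Faithful := ⟨fun {X Y} {f f'} h => by
    apply ObjectProperty.hom_ext
    apply BCat.hom_ext_apply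
    intro x
    rw [← hΨ f x, ← hΨ f' x, h]⟩
  /- ## full -/
  haveI : Ψ.Full := ⟨fun {X Y} φ => by
    refine ⟨ObjectProperty.homMk (ObjectProperty.homMk
      { hom := FintypeCat.homMk fun x : X.obj.obj.V => (φ.hom.hom.hom x : Y.obj.obj.V)
        comm := fun g => ?_ }), ?_⟩
    · apply FintypeCat.hom_ext
      intro x
      simp only [FintypeCat.comp_apply, FintypeCat.homMk_apply]
      exact BTempConnected.hom_ρ φ.hom g x
    · apply ObjectProperty.hom_ext
      apply BTempConnected.hom_ext_apply
      intro x
      rw [hΨ]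
      exact FintypeCat.homMk_apply _ _⟩
  /- ## essentially surjective -/
  haveI : Ψ.EssSurj := ⟨fun T' => by
    obtain ⟨t₀⟩ := BTempConnected.nonempty_of_isConnectedObj T'.obj T'.property
    have htr' := BTempConnected.exists_ρ_eq_of_isConnectedObj T'.obj T'.property t₀
    -- the stabiliser of `t₀`: an open subgroup of finite index
    let U : Subgroup G :=
      { carrier := {g : G | T'.obj.obj.ρ g t₀ = t₀}
        mul_mem' := fun {a b} ha hb => by
          change T'.obj.obj.ρ (a * b) t₀ = t₀
          rw [BTempConnected.ρ_mul_apply, hb, ha]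
        one_mem' := BTempConnected.ρ_one_apply T'.obj t₀
        inv_mem' := fun {a} ha => by
          change T'.obj.obj.ρ a⁻¹ t₀ = t₀
          conv_lhs => rw [← ha]
          rw [BTempConnected.ρ_inv_apply] }
    have hU : IsOpen (U : Set G) := T'.obj.property.2 t₀
    haveI : Finite (G ⧸ U) := Subgroup.quotient_finite_of_isOpen U hU
    haveI : U.FiniteIndex := Subgroup.finiteIndex_of_finite_quotient
    obtain ⟨Q, q₀, hstab, htrQ, -⟩ := BCat.exists_coset_obj U hU
    have hQ : IsConnectedObj Q := BCat.isConnectedObj_of_transitive Q q₀ htrQ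
    -- the comparison morphism `Π/U → T'`, `q₀ ↦ t₀`
    obtain ⟨b, hb⟩ := BTempConnected.exists_hom_of_stabilizer_le (T₁ := T Q) (T₂ := T'.obj) q₀
      (fun r => htrQ r) t₀ fun g hg => by
        have hg' : g ∈ MulAction.stabilizer G q₀ := hg
        rw [hstab] at hg'
        exact hg'
    have hinj : Function.Injective (fun x : Q.obj.V => (b.hom.hom x : T'.obj.obj.V)) := by
      intro x x' hxx'
      obtain ⟨g, rfl⟩ := htrQ x
      obtain ⟨g', rfl⟩ := htrQ x'
      have e₁ : (b.hom.hom (g • q₀) : T'.obj.obj.V) = T'.obj.obj.ρ g t₀ := by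
        rw [← hb]; exact BTempConnected.hom_ρ b g q₀
      have e₂ : (b.hom.hom (g' • q₀) : T'.obj.obj.V) = T'.obj.obj.ρ g' t₀ := by
        rw [← hb]; exact BTempConnected.hom_ρ b g' q₀
      have e : T'.obj.obj.ρ g t₀ = T'.obj.obj.ρ g' t₀ := by rw [← e₁, ← e₂]; exact hxx'
      have hmem : g⁻¹ * g' ∈ U := by
        change T'.obj.obj.ρ (g⁻¹ * g') t₀ = t₀
        rw [BTempConnected.ρ_mul_apply, ← e, BTempConnected.ρ_inv_apply]
      rw [← hstab, MulAction.mem_stabilizer_iff, mul_smul, inv_smul_eq_iff] at hmem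
      exact hmem.symm
    have hsurj : Function.Surjective (fun x : Q.obj.V => (b.hom.hom x : T'.obj.obj.V)) :=
      fun y => BTempConnected.surjective_of_isConnectedObj q₀ T'.property b y
    let b' : Ψ.obj ⟨Q, hQ⟩ ⟶ T' := ObjectProperty.homMk b
    haveI : IsIso b.hom.hom := (isIso_iff_bijective _).mpr ⟨hinj, hsurj⟩
    haveI : IsIso b.hom := inferInstance
    haveI : IsIso b := (ObjectProperty.isIso_hom_iff _).mp inferInstance
    haveI : IsIso b' := (ObjectProperty.isIso_hom_iff _).mp (by change IsIso b; infer_instance)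
    exact ⟨⟨Q, hQ⟩, ⟨asIso b'⟩⟩⟩
  haveI : Ψ.IsEquivalence := {}
  exact ⟨Ψ.asEquivalence.symm⟩

variable (G) in
/-- `ConnectedPartEquivOfProfinite` — `_holds` alias of `connectedPartEquivOfProfinite_holds` above under the fact's exact name (appended
2026-08-28, D-0026 bookkeeping: the proof term is the existing theorem of this file; no statement,
definition or attribute is edited; no new named fact; the ledger's debt table listed the fact
unproved). [cite: MochizukiFrdII2008, Ex 1.3 (i) p.11] -/
theorem _root_.Literature.AlgebraicGeometry.Frobenioids.QuasiTemperoid.ConnectedPartEquivOfProfinite_holds :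
    ConnectedPartEquivOfProfinite G :=
  _root_.Literature.AlgebraicGeometry.Frobenioids.QuasiTemperoid.connectedPartEquivOfProfinite_holds (G := G)

end QuasiTemperoid

end Literature.AlgebraicGeometry.Frobenioids
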